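import Mathlib
import HarnessLib
import Summits.ValiantsHypothesis.ValiantsHypothesis.Theses.MonotoneRestoration
import Literature.Computability.AlgebraicComplexity.ArithCircuit
import Literature.Computability.AlgebraicComplexity.ArithCircuitProofs
import Literature.Computability.AlgebraicComplexity.MonotoneStructure
import Literature.Computability.AlgebraicComplexity.PermanentIrreducible
import Literature.ModelTheory.FiniteModelTheory.CkEquiv
import Summits.ValiantsHypothesis.ValiantsHypothesis.Theorems.MonotoneRestorationMonotoneRestorationQPCosetCount
import Summits.ValiantsHypothesis.ValiantsHypothesis.Theorems.MonotoneRestorationMonotoneRestorationQPSymmetricLB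
import Summits.ValiantsHypothesis.ValiantsHypothesis.Theorems.MonotoneRestorationMonotoneRestorationQPSupportSymmetrisation
import Summits.ValiantsHypothesis.ValiantsHypothesis.Theorems.MonotoneRestorationMonotoneRestorationQPSparseRegime
import Summits.ValiantsHypothesis.ValiantsHypothesis.Theorems.MonotoneRestorationMonotoneRestorationQPBeta
import Literature.Computability.AlgebraicComplexity.SymmetricArithCircuit
import Literature.Computability.AlgebraicComplexity.DawarWilsenach2025Proofs
import Literature.GroupTheory.PermutationGroups.SmallIndexSubgroups
import Summits.ValiantsHypothesis.ValiantsHypothesis.Theorems.MonotoneRestorationQP.Negative.LoadBearing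
import Summits.ValiantsHypothesis.ValiantsHypothesis.Theorems.MonotoneRestorationMonotoneRestorationQPPermSupportCount

/-! TTRL-lite variant V19403 of stmt-ValiantsHypothesis-15886 -/

-- `Summit.ValiantsHypothesis.ValiantsHypothesis.…` is the tree's mandated single-conjunct layout
-- (Sub = Summit), so the duplicated namespace component is intended.
set_option linter.dupNamespace false

namespace Summit.ValiantsHypothesis.ValiantsHypothesis.Theorems

open Summit.ValiantsHypothesis.ValiantsHypothesis.Theses.MonotoneRestoration
open Literature.Computability.AlgebraicComplexity

/-- TTRL-lite variant V19403 of `stmt-ValiantsHypothesis-15886` (stub `gammaArithmetic`):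
for `c ≥ 1` the additive `+2` folds into the base of the power,
`(L + c) ^ c + 2 ≤ (L + c + 2) ^ c`. Proof: with `x = L + c ≥ 1` and `c = d + 1`,
`(x+2)^(d+1) = (x+2)^d (x+2) ≥ x^d (x+2) = x^(d+1) + 2 x^d ≥ x^(d+1) + 2`. -/
theorem gammaArithmetic_var19403 :
    ∀ (L c : ℕ), 1 ≤ c → (L + c) ^ c + 2 ≤ (L + c + 2) ^ c := by
  intro L c hc
  obtain ⟨d, rfl⟩ : ∃ d, c = d + 1 := ⟨c - 1, by omega⟩
  have hx : 1 ≤ (L + (d + 1)) ^ d := Nat.one_le_pow _ _ (by omega)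
  have hmono : (L + (d + 1)) ^ d ≤ (L + (d + 1) + 2) ^ d :=
    Nat.pow_le_pow_left (by omega) d
  rw [pow_succ, pow_succ]
  nlinarith [hx, hmono, Nat.zero_le L, Nat.zero_le d]

end Summit.ValiantsHypothesis.ValiantsHypothesis.Theorems
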